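import Summits.BirchSwinnertonDyer.BirchSwinnertonDyer.Theorems.Rank1ResidualIntModelReduction
import Literature.NumberTheory.EllipticCurves.RootNumberTableTwo
import Literature.NumberTheory.EllipticCurves.SzpiroOfAbcProofs
import Literature.NumberTheory.EllipticCurves.BSDRootNumber
import Literature.NumberTheory.EllipticCurves.BSDConductor
import Literature.NumberTheory.EllipticCurves.SzpiroLocalDataProofs
import Literature.NumberTheory.EllipticCurves.QuadraticTwistKroneckerLFunctionProofs
import Literature.NumberTheory.EllipticCurves.BSDRootNumberPrimesEquivProofs
import Literature.NumberTheory.EllipticCurves.MinimalModelReduction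
import Literature.NumberTheory.DiophantineGeometry.LocalReductionFiniteBadPlacesProofs
import Literature.NumberTheory.DiophantineGeometry.LocalReductionProofs
import Literature.RingTheory.DiscreteValuationRing.AdicCompletionResidueField
import HarnessLib

/-!
# BSD rank ≥ 2 observatory (`b2b-bsdr2`): local root numbers of an INTEGER MODEL at the places of
# `ℤ`, read off `p ∣ Δ`, `p ∤ c₄` and a root / a non-residue modulo `p` (semistable places)

HONEST FRAMING: per-curve certified theorems and census instruments; no claim on BSD in rank ≥ 2.

Theorems only (no definition of mathematical content beyond two abbreviations, no named fact).
Purpose: the rank-3 census theorems of the cell (`Rank2ObservatoryRank3KernelCertsCensus`,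
`Rank3Row.analyticRank_eq_rank_kernel`) carry the hypothesis `hw : rootNumber = -1`.  The tree's
named fact `WeierstrassCurve.rootNumber_eq_neg_finprod_tableLocalRootNumberAt'`
(`RootNumberTableTwo`, Kellock–Dokchitser 2023 Thm. 2.3 and §5, rows `(0,5,2)` corrected after
Rizzo 2003) expresses `w(E)` as `−∏ᵥ W.tableLocalRootNumberAt' v` over the finite places `v` of `ℤ`:
Rohrlich's case list `W.localRootNumberAt v` away from `2`, the corrected `ℚ₂` table above `2`.
This file evaluates the factors AWAY FROM `2` at the semistable places of an integer equation
`W₀ : WeierstrassCurve ℤ` (the curve being `W₀.baseChange ℚ`), in the kernel-checkable terms the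
companion certificate file `Rank2ObservatoryRootNumberCert` decides:

* `hasGoodReductionAt_of_not_dvd` / `localRootNumberAt_eq_one_of_not_dvd` — `p ∤ Δ(W₀)` ⟹ good
  reduction at the place over `p`, `w_p = 1` (Silverman *AEC* VII.5.1(a); Rohrlich 1993 Prop. 2(i));
* `hasMultiplicativeReductionAt_of_dvd_of_not_dvd` — `p ∣ Δ(W₀)`, `p ∤ c₄(W₀)` ⟹ multiplicative
  (the equation is then minimal at `p`, Silverman VII.1 Rem. 1.1, VII.5.1(b));
* `hasSplitMultiplicativeReductionAt_iff_splits` — at such `p`, split iff the node-tangent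
  quadratic `c₄T² + a₁c₄T − (54b₆ − 3b₂b₄ + a₂c₄)` of `W₀` splits modulo `p` (port to the places
  of `ℤ` of the tree's `𝓞 ℚ`-place theorem of `HondaStrongIsomorphismMultiplicativeProofs`);
* `localRootNumberAt_eq_neg_one_of_root` (`w_p = −1` from a root mod `p`) and
  `localRootNumberAt_eq_one_of_pow_eq_neg_one` (`w_p = +1` when the discriminant of that quadratic
  is a non-residue by Euler's criterion, `p` odd) (Rohrlich 1993 Prop. 2(ii));
* `not_hasAdditiveReductionAt_three` — the guard of the named fact at the place of `3`;
* `finprod_eq_prod_map_natPlace` — a finitely supported product over the places of `ℤ` as a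
  product over a duplicate-free list of primes containing the support.

References: J. H. Silverman, *AEC* 2nd ed. (2009), VII.1 Rem. 1.1, VII.5 Prop. 5.1
[SilvermanAEC2009]; D. Rohrlich, Compositio Math. 87 (1993), Prop. 2 [Rohrlich1993Compositio];
A. Kellock, V. Dokchitser, *Root numbers and parity phenomena*, Bull. LMS 55 (2023), Def. 2.1,
Thm. 2.3, §5 [KellockDokchitser2023].
-/

set_option linter.dupNamespace false
set_option autoImplicit false

noncomputable section

open scoped Classical

open IsDedekindDomain Rat.HeightOneSpectrum WeierstrassCurve Polynomial

namespace Summit.BirchSwinnertonDyer.BirchSwinnertonDyer.Rank2Observatory.RootNumber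

/-! ### Places of `ℤ` named by natural numbers -/

/-- The finite place of `ℤ` over the natural number `p`: `primesEquiv.symm p` for a prime `p`
(the place of `2` as a junk value otherwise) — a TOTAL function of `p : ℕ` (no primality instance),
so that certificates can list bad primes as plain numerals. [folklore] -/
def natPlace (p : ℕ) : HeightOneSpectrum ℤ :=
  if hp : p.Prime then (primesEquiv (R := ℤ)).symm ⟨p, hp⟩
  else (primesEquiv (R := ℤ)).symm ⟨2, Nat.prime_two⟩

/-- The prime under `natPlace p` is `p`. [folklore] -/
theorem natGenerator_natPlace {p : ℕ} (hp : p.Prime) : natGenerator (natPlace p) = p := by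
  rw [natPlace, dif_pos hp]
  exact congrArg Subtype.val ((primesEquiv (R := ℤ)).apply_symm_apply ⟨p, hp⟩)

/-- `natPlace` is a left inverse of `natGenerator`. [folklore] -/
theorem natPlace_natGenerator (v : HeightOneSpectrum ℤ) : natPlace (natGenerator v) = v := by
  rw [natPlace, dif_pos (prime_natGenerator v), Equiv.symm_apply_eq]
  rfl

/-- The residue ring `ℤ ⧸ v` has characteristic the prime under `v`. [folklore] -/
theorem ringChar_quot_eq (v : HeightOneSpectrum ℤ) : ringChar (ℤ ⧸ v.asIdeal) = natGenerator v :=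
  Literature.NumberTheory.EllipticCurves.Rat.ringChar_int_quotient_asIdeal v

/-- **A finitely supported product over the places of `ℤ` as a list product**: if `f v = 1` unless
the prime under `v` lies in the duplicate-free list of primes `L`, then
`∏ᶠ_v f v = ∏_{p ∈ L} f (natPlace p)`. [folklore] -/
theorem finprod_eq_prod_map_natPlace {M : Type*} [CommMonoid M] (f : HeightOneSpectrum ℤ → M)
    (L : List ℕ) (hL : L.Nodup) (hprime : ∀ p ∈ L, p.Prime)
    (hf : ∀ v, natGenerator v ∉ L → f v = 1) :
    ∏ᶠ v, f v = (L.map fun p => f (natPlace p)).prod := by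
  classical
  have hinj : ∀ p ∈ L, ∀ q ∈ L, natPlace p = natPlace q → p = q := fun p hp q hq h ↦ by
    rw [← natGenerator_natPlace (hprime p hp), h, natGenerator_natPlace (hprime q hq)]
  have hnd : (L.map natPlace).Nodup := hL.map_on hinj
  have hsupp : Function.mulSupport f ⊆ ((L.map natPlace).toFinset : Set (HeightOneSpectrum ℤ)) := by
    intro v hv
    rw [Function.mem_mulSupport] at hv
    rw [Finset.mem_coe, List.mem_toFinset, List.mem_map]
    by_contra h
    refine hv (hf v fun hmem ↦ h ⟨natGenerator v, hmem, natPlace_natGenerator v⟩)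
  rw [finprod_eq_prod_of_mulSupport_subset f hsupp, List.prod_toFinset _ hnd, List.map_map]
  rfl

/-! ### The residue field of `O_v`, `v` a place of `ℤ` -/

/-- `κ(O_v) ≃ ℤ/p` for the place `v` of `ℤ` over `p` (`ℤ ⧸ v ≃ κ(O_v)` of the tree's
`AdicCompletionResidueField`, and `v = (p)`). [folklore] -/
def residueFieldEquivZMod (v : HeightOneSpectrum ℤ) :
    IsLocalRing.ResidueField (v.adicCompletionIntegers ℚ) ≃+* ZMod (natGenerator v) :=
  (HeightOneSpectrum.residueFieldEquiv ℚ v).symm.trans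
    ((Ideal.quotEquivOfEq (asIdeal_eq_span_natGenerator v)).trans (Int.quotientSpanNatEquivZMod _))

/-- `|κ(O_v)| = p`. [folklore] -/
theorem natCard_residueField (v : HeightOneSpectrum ℤ) :
    Nat.card (IsLocalRing.ResidueField (v.adicCompletionIntegers ℚ)) = natGenerator v := by
  rw [Nat.card_congr (residueFieldEquivZMod v).toEquiv, Nat.card_zmod]

/-- `char κ(O_v) = p`. [folklore] -/
theorem ringChar_residueField (v : HeightOneSpectrum ℤ) :
    ringChar (IsLocalRing.ResidueField (v.adicCompletionIntegers ℚ)) = natGenerator v := by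
  haveI : CharP (IsLocalRing.ResidueField (v.adicCompletionIntegers ℚ)) (natGenerator v) :=
    charP_of_injective_ringHom (f := (residueFieldEquivZMod v).symm.toRingHom)
      (fun a b h ↦ (residueFieldEquivZMod v).symm.injective h) (natGenerator v)
  exact ringChar.eq _ _

/-! ### Reduction of an integer equation at a place of `ℤ` -/

section IntModel

variable {v : HeightOneSpectrum ℤ} {W₀ : WeierstrassCurve ℤ}

/-- Mathlib's chosen `O_v`-integral model of `W₀ ⊗ ℚ_v` is `W₀` itself (read in `O_v`): lifts along
the injection `O_v ↪ ℚ_v` are unique. [folklore] -/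
theorem integralModel_baseChange_adicCompletion (v : HeightOneSpectrum ℤ) (W₀ : WeierstrassCurve ℤ)
    [IsIntegral (v.adicCompletionIntegers ℚ) ((W₀.baseChange ℚ).baseChange (v.adicCompletion ℚ))] :
    integralModel (v.adicCompletionIntegers ℚ) ((W₀.baseChange ℚ).baseChange (v.adicCompletion ℚ)) =
      W₀.map (Int.castRingHom (v.adicCompletionIntegers ℚ)) := by
  refine integralModel_eq_of_baseChange_eq _ _ ?_
  ext <;> simp [baseChange, WeierstrassCurve.map]

/-- **Good reduction from `p ∤ Δ(W₀)`** (Silverman *AEC* VII.5.1(a): an integral equation with unit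
discriminant is minimal with nonsingular reduction). [cite: SilvermanAEC2009, VII.5 Prop. 5.1(a)] -/
theorem hasGoodReductionAt_of_not_dvd (h : ¬ (natGenerator v : ℤ) ∣ W₀.Δ) :
    (W₀.baseChange ℚ).HasGoodReductionAt v :=
  hasGoodReductionAt_of_valuation_Δ_eq_one_holds v (W₀.baseChange ℚ)
    (isIntegralAt_baseChange_int v W₀)
    (by rw [baseChange_int_Δ]
        exact (Literature.NumberTheory.EllipticCurves.Rat.valuation_intCast_eq_one_iff v _).mpr h)

/-- `w_p = 1` at `p ∤ Δ(W₀)` (Rohrlich 1993, Prop. 2(i)). [cite: Rohrlich1993Compositio, Prop. 2(i)] -/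
theorem localRootNumberAt_eq_one_of_not_dvd (h : ¬ (natGenerator v : ℤ) ∣ W₀.Δ) :
    (W₀.baseChange ℚ).localRootNumberAt v = 1 :=
  WeierstrassCurve.localRootNumberAt_of_hasGoodReductionAt (hasGoodReductionAt_of_not_dvd h)

/-- **Multiplicative reduction from `p ∣ Δ(W₀)`, `p ∤ c₄(W₀)`** (Silverman *AEC* VII.1 Rem. 1.1:
the equation is minimal at `p`; VII.5.1(b)). [cite: SilvermanAEC2009, VII.5 Prop. 5.1(b)] -/
theorem hasMultiplicativeReductionAt_of_dvd_of_not_dvd [(W₀.baseChange ℚ).IsElliptic]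
    (hΔ : (natGenerator v : ℤ) ∣ W₀.Δ) (hc₄ : ¬ (natGenerator v : ℤ) ∣ W₀.c₄) :
    (W₀.baseChange ℚ).HasMultiplicativeReductionAt v :=
  (hasMultiplicativeReductionAt_iff_of_isMinimalAt (isMinimalAt_baseChange_int_of_not_dvd_c₄ hc₄)).mpr
    ⟨by rw [baseChange_int_Δ]
        exact (Literature.NumberTheory.EllipticCurves.Rat.valuation_intCast_lt_one_iff v _).mpr hΔ,
     by rw [baseChange_int_c₄]
        exact (Literature.NumberTheory.EllipticCurves.Rat.valuation_intCast_eq_one_iff v _).mpr hc₄⟩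

/-- **The guard of the named fact**: if `p ∤ Δ(W₀)` or `p ∤ c₄(W₀)` then `W₀ ⊗ ℚ` does not have
additive reduction at the place over `p` (good resp. multiplicative reduction exclude it;
Silverman *AEC* VII.5.1). [cite: SilvermanAEC2009, VII.5 Prop. 5.1] -/
theorem not_hasAdditiveReductionAt_of_not_dvd_or [(W₀.baseChange ℚ).IsElliptic]
    (h : ¬ (natGenerator v : ℤ) ∣ W₀.Δ ∨ ¬ (natGenerator v : ℤ) ∣ W₀.c₄) :
    ¬ (W₀.baseChange ℚ).HasAdditiveReductionAt v := by
  by_cases hΔ : (natGenerator v : ℤ) ∣ W₀.Δ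
  · have hc₄ : ¬ (natGenerator v : ℤ) ∣ W₀.c₄ := h.resolve_left (not_not.mpr hΔ)
    exact (hasMultiplicativeReductionAt_of_dvd_of_not_dvd hΔ hc₄).not_hasAdditiveReductionAt
  · exact (hasGoodReductionAt_of_not_dvd hΔ).not_hasAdditiveReductionAt

/-- **Split multiplicative reduction is read on the integer model mod `p`** (port to the places of
`ℤ` of the tree's `hasSplitMultiplicativeReductionAt_iff_splits` over `𝓞 ℚ`): at `p ∣ Δ(W₀)`,
`p ∤ c₄(W₀)`, the elliptic `W₀ ⊗ ℚ` has split multiplicative reduction at the place over `p` iff the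
node-tangent quadratic `c₄T² + a₁c₄T − (54b₆ − 3b₂b₄ + a₂c₄)` of `W₀` splits over `𝔽_p` (the
equation is minimal at `p`; model independence, Silverman VII.1.3(b); `κ(v) ≃ ℤ/p`).
[cite: SilvermanAEC2009, VII.5 Prop. 5.1(b) and VII.1 Prop. 1.3(b)] -/
theorem hasSplitMultiplicativeReductionAt_iff_splits [(W₀.baseChange ℚ).IsElliptic]
    (hΔ : (natGenerator v : ℤ) ∣ W₀.Δ) (hc₄ : ¬ (natGenerator v : ℤ) ∣ W₀.c₄) :
    (W₀.baseChange ℚ).HasSplitMultiplicativeReductionAt v ↔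
      (letI I := W₀.map (Int.castRingHom (ZMod (natGenerator v)));
        (C I.c₄ * X ^ 2 + C (I.a₁ * I.c₄) * X
          - C (54 * I.b₆ - 3 * I.b₂ * I.b₄ + I.a₂ * I.c₄)).Splits) := by
  haveI : Fact (natGenerator v).Prime := ⟨prime_natGenerator v⟩
  set O := v.adicCompletionIntegers ℚ with hO
  set Y := (W₀.baseChange ℚ).baseChange (v.adicCompletion ℚ) with hY
  haveI hint : IsIntegral O Y := isIntegralAt_baseChange_int v W₀
  haveI hmin : Y.IsMinimal O := isMinimalAt_baseChange_int_of_not_dvd_c₄ hc₄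
  have hΔ0 : Y.Δ ≠ 0 := by
    rw [hY, baseChange, map_Δ]
    exact (_root_.map_ne_zero _).mpr (W₀.baseChange ℚ).isUnit_Δ.ne_zero
  obtain ⟨D, hD⟩ : ∃ D : VariableChange (v.adicCompletion ℚ),
      (W₀.baseChange ℚ).localMinimalModel v = D • Y := ⟨_, rfl⟩
  have hmult : Y.HasMultiplicativeReduction O :=
    (hasMultiplicativeReduction_iff_of_isMinimal_of_eq_smul O hD hΔ0).mp
      (hasMultiplicativeReductionAt_of_dvd_of_not_dvd hΔ hc₄)
  unfold HasSplitMultiplicativeReductionAt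
  haveI := hmult
  rw [hasSplitMultiplicativeReduction_iff_of_isMinimal_of_eq_smul O hD hΔ0,
    hasSplitMultiplicativeReduction_iff]
  refine (exists_prop_of_true hmult).trans ?_
  rw [integralModel_baseChange_adicCompletion v W₀, nodalTangents_map, nodalTangents_map,
    Polynomial.map_map]
  rw [← WeierstrassCurve.splits_map_ringEquiv_iff (residueFieldEquivZMod v), Polynomial.map_map]
  congr! 2
  exact RingHom.ext_int _ _

/-- **`w_p = −1` from a root** of the node-tangent quadratic of `W₀` modulo `p` (`p ∣ Δ(W₀)`,
`p ∤ c₄(W₀)`: split multiplicative reduction; Rohrlich 1993, Prop. 2(ii)).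
[cite: Rohrlich1993Compositio, Prop. 2(ii)] -/
theorem localRootNumberAt_eq_neg_one_of_root [(W₀.baseChange ℚ).IsElliptic]
    (hΔ : (natGenerator v : ℤ) ∣ W₀.Δ) (hc₄ : ¬ (natGenerator v : ℤ) ∣ W₀.c₄) {t : ℤ}
    (ht : (natGenerator v : ℤ) ∣ W₀.c₄ * t ^ 2 + W₀.a₁ * W₀.c₄ * t
      - (54 * W₀.b₆ - 3 * W₀.b₂ * W₀.b₄ + W₀.a₂ * W₀.c₄)) :
    (W₀.baseChange ℚ).localRootNumberAt v = -1 := by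
  haveI : Fact (natGenerator v).Prime := ⟨prime_natGenerator v⟩
  apply WeierstrassCurve.localRootNumber_of_hasSplitMultiplicativeReduction
  change (W₀.baseChange ℚ).HasSplitMultiplicativeReductionAt v
  rw [hasSplitMultiplicativeReductionAt_iff_splits hΔ hc₄]
  refine Splits.of_degree_eq_two (Rank1Residual.IntModel.degree_nodal_eq_two W₀ _ hc₄)
    (x := (t : ZMod (natGenerator v))) ?_
  have h0 := (ZMod.intCast_zmod_eq_zero_iff_dvd _ (natGenerator v)).mpr ht
  push_cast at h0
  simp only [eval_sub, eval_add, eval_mul, eval_C, eval_X, eval_pow, map_c₄, map_b₂, map_b₄,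
    map_b₆, map_a₁, map_a₂, eq_intCast]
  linear_combination h0

/-- The discriminant `(a₁c₄)² + 4c₄(54b₆ − 3b₂b₄ + a₂c₄)` of the node-tangent quadratic
`c₄T² + a₁c₄T − (54b₆ − 3b₂b₄ + a₂c₄)` of an integer equation. [folklore] -/
def nodalDisc (W₀ : WeierstrassCurve ℤ) : ℤ :=
  (W₀.a₁ * W₀.c₄) ^ 2 + 4 * W₀.c₄ * (54 * W₀.b₆ - 3 * W₀.b₂ * W₀.b₄ + W₀.a₂ * W₀.c₄)

/-- **`w_p = +1` from Euler's criterion** (`p ∣ Δ(W₀)`, `p ∤ c₄(W₀)`, `p` odd): if the discriminant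
`d` of the node-tangent quadratic satisfies `d^{(p−1)/2} = −1` in `ℤ/p`, then `d` is not a square,
the quadratic has no root modulo `p`, the reduction is non-split multiplicative, and `w_p = 1`
(Rohrlich 1993, Prop. 2(ii)). [cite: Rohrlich1993Compositio, Prop. 2(ii)] -/
theorem localRootNumberAt_eq_one_of_pow_eq_neg_one [(W₀.baseChange ℚ).IsElliptic]
    (hΔ : (natGenerator v : ℤ) ∣ W₀.Δ) (hc₄ : ¬ (natGenerator v : ℤ) ∣ W₀.c₄)
    (h2 : natGenerator v ≠ 2)
    (heuler : ((nodalDisc W₀ : ℤ) : ZMod (natGenerator v)) ^ (natGenerator v / 2) = -1) :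
    (W₀.baseChange ℚ).localRootNumberAt v = 1 := by
  haveI : Fact (natGenerator v).Prime := ⟨prime_natGenerator v⟩
  haveI : Fact (2 < natGenerator v) :=
    ⟨lt_of_le_of_ne (prime_natGenerator v).two_le (Ne.symm h2)⟩
  have hm := hasMultiplicativeReductionAt_of_dvd_of_not_dvd hΔ hc₄
  refine WeierstrassCurve.localRootNumber_of_hasMultiplicativeReduction _ _ hm ?_
  change ¬ (W₀.baseChange ℚ).HasSplitMultiplicativeReductionAt v
  rw [hasSplitMultiplicativeReductionAt_iff_splits hΔ hc₄]
  intro hs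
  obtain ⟨t, ht⟩ := hs.exists_eval_eq_zero
    (by rw [Rank1Residual.IntModel.degree_nodal_eq_two W₀ _ hc₄]; decide)
  simp only [eval_sub, eval_add, eval_mul, eval_C, eval_X, eval_pow, map_c₄, map_b₂, map_b₄,
    map_b₆, map_a₁, map_a₂, eq_intCast] at ht
  have hsq : IsSquare ((nodalDisc W₀ : ℤ) : ZMod (natGenerator v)) := by
    refine ⟨2 * (W₀.c₄ : ZMod (natGenerator v)) * t + (W₀.a₁ * W₀.c₄ : ℤ), ?_⟩
    have hd := discrim_eq_sq_of_quadratic_eq_zero (a := (W₀.c₄ : ZMod (natGenerator v)))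
      (b := ((W₀.a₁ * W₀.c₄ : ℤ) : ZMod (natGenerator v)))
      (c := -((54 * W₀.b₆ - 3 * W₀.b₂ * W₀.b₄ + W₀.a₂ * W₀.c₄ : ℤ) : ZMod (natGenerator v)))
      (x := t) (by push_cast; linear_combination ht)
    rw [discrim] at hd
    simp only [nodalDisc]
    push_cast at hd ⊢
    linear_combination hd
  have hne : ((nodalDisc W₀ : ℤ) : ZMod (natGenerator v)) ≠ 0 := by
    intro h0
    rw [h0, zero_pow (Nat.div_pos (prime_natGenerator v).two_le two_pos).ne'] at heuler
    exact one_ne_zero (neg_eq_zero.mp heuler.symm)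
  rw [ZMod.euler_criterion (natGenerator v) hne] at hsq
  rw [hsq] at heuler
  exact ZMod.neg_one_ne_one heuler.symm

/-! ### The factors of the named fact `rootNumber_eq_neg_finprod_tableLocalRootNumberAt'` -/

/-- The corrected table-local root number at the place over `p`: the `ℚ₂` table value at `p = 2`,
Rohrlich's value elsewhere. [cite: KellockDokchitser2023, Thm. 2.3 and §5] -/
theorem tableLocalRootNumberAt'_eq_ite (W : WeierstrassCurve ℚ) (v : HeightOneSpectrum ℤ) :
    W.tableLocalRootNumberAt' v =
      if natGenerator v = 2 then W.rootNumberTwo' else W.localRootNumberAt v := by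
  unfold WeierstrassCurve.tableLocalRootNumberAt'
  rw [ringChar_quot_eq]

/-- **The finite product of the named fact as a list product over the bad primes and `2`**: for a
duplicate-free list `L` of primes containing `2` and every prime factor of `Δ(W₀)`,
`∏ᶠ_v W.tableLocalRootNumberAt' v = ∏_{p ∈ L} W.tableLocalRootNumberAt' (natPlace p)`
(`w_v = 1` at the good places away from `2`). [cite: KellockDokchitser2023, Def. 2.1 and Thm. 2.3] -/
theorem finprod_tableLocalRootNumberAt'_eq_prod (L : List ℕ) (hL : L.Nodup) (h2 : 2 ∈ L)
    (hprime : ∀ p ∈ L, p.Prime) (hcover : ∀ p : ℕ, p.Prime → (p : ℤ) ∣ W₀.Δ → p ∈ L) :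
    ∏ᶠ v, (W₀.baseChange ℚ).tableLocalRootNumberAt' v =
      (L.map fun p => (W₀.baseChange ℚ).tableLocalRootNumberAt' (natPlace p)).prod := by
  refine finprod_eq_prod_map_natPlace _ L hL hprime fun v hv ↦ ?_
  have h2' : natGenerator v ≠ 2 := fun h ↦ hv (h ▸ h2)
  have hΔ : ¬ (natGenerator v : ℤ) ∣ W₀.Δ := fun h ↦ hv (hcover _ (prime_natGenerator v) h)
  rw [tableLocalRootNumberAt'_eq_ite, if_neg h2', localRootNumberAt_eq_one_of_not_dvd hΔ]

/-- **The guard at `3`**: if `3 ∤ Δ(W₀)` or `3 ∤ c₄(W₀)`, the elliptic `W₀ ⊗ ℚ` has no additive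
reduction at the place of residue characteristic `3`. [cite: SilvermanAEC2009, VII.5 Prop. 5.1] -/
theorem guard_three [(W₀.baseChange ℚ).IsElliptic]
    (h3 : ¬ (3 : ℤ) ∣ W₀.Δ ∨ ¬ (3 : ℤ) ∣ W₀.c₄) (v : HeightOneSpectrum ℤ)
    (hadd : (W₀.baseChange ℚ).HasAdditiveReductionAt v) : ringChar (ℤ ⧸ v.asIdeal) ≠ 3 := by
  rw [ringChar_quot_eq]
  intro hv
  refine not_hasAdditiveReductionAt_of_not_dvd_or ?_ hadd
  rw [hv]
  exact_mod_cast h3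

end IntModel

end Summit.BirchSwinnertonDyer.BirchSwinnertonDyer.Rank2Observatory.RootNumber

end
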